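import Literature.Barriers.CriticalPhenomena.LaceExpansionMeanField
import Literature.Probability.RandomPlanarGeometry.SAWCount
import HarnessLib

/-!
# Hara–Slade 1992: the bubble condition in dimensions `d ≥ 5` — decomposition of
# `HaraSlade1992_bubbleCondition`, layer 1 (Part I, Theorem 2.5 ⇒ `B(z_c) < ∞`)

Barrier catalogue `Literature/Barriers/CriticalPhenomena/` (D-0021), sibling of
`LaceExpansionMeanField.lean`, whose named fact

* `Literature.Barriers.CriticalPhenomena.HaraSlade1992_bubbleCondition : ∀ d ≥ 5, BubbleCondition d`
  (`B(z_c) = Σ_x G_{z_c}(x)² < ∞` for the nearest-neighbour strictly self-avoiding walk)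

is the theorem of Hara–Slade 1992 (Part I: Commun. Math. Phys. 147; Part II: Rev. Math. Phys. 4),
quoted by Madras–Slade 1993, §6.1 (p. 172: "all of the results stated in this section … have
been proven in Hara and Slade (1992a,b) for the nearest-neighbour model for `d ≥ 5`"; proof of
Corollary 6.1.7). Its printed proof is a theory — the lace expansion (Part I, Thm. 2.2), the
diagrammatic estimates (Part I, Lemmas 2.3–2.4, refined in Part II), computer-assisted bounds on
simple-random-walk quantities in `d = 5` and a continuity ("bootstrap") argument (Part II,
Thm. 1.1) — so the fact is decomposed (provefact triage XL) and this file lands the top layer.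

## What the source prints (T. Hara, G. Slade, *Self-avoiding walk in five or more dimensions. I.
## The critical behaviour*, Commun. Math. Phys. 147 (1992) 101–136)

* (2.15): `G_z^{(1)}(x) = Σ_{n=1}^∞ cₙ(x) zⁿ = G_z(x) - δ_{0,x}`; (1.14): the bubble diagram of
  that paper is `B(z) = Σ_{x ≠ 0} G_z(x)²`, and §3.1: "The bubble diagram is defined by
  `B(z) = ‖G_z^{(1)}(x)‖₂²`." (The bubble diagram of Slade 2006 (2.30) / Madras–Slade (1.5.4),
  formalised as `bubbleDiagram`, includes the term `x = 0` and is therefore `1 +` this one: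
  `bubbleDiagram_eq_one_add_hsBubble`.)
* **Theorem 2.5** (§2.3 "Bounds Required from Part II … See Theorem II.1.1 for the proofs of
  these results"): "Let `d ≥ 5`. There are constants `C₁`, `C₂` such that for any `z` with
  `|z| ≤ z_c`, `‖|x|² G_z(x)‖_∞ ≤ C₁` and `‖G_z^{(1)}(x)‖₂² ≤ C₂`, with `C₂(1 + C₂) < 1`, i.e.,
  (2.18) is satisfied." (`|x|` is the Euclidean norm, §1.1.)
* §3.1, proof of Theorem 1.2: "It was shown in [5] that if `B(z_c) < ∞`, then …
  `c₁(z_c - p)⁻¹ ≤ χ(p) ≤ c₂(z_c - p)⁻¹` (3.1). Thus by Theorem 2.5 and the results of [5],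
  (3.1) holds." — i.e. Theorem 2.5 gives the bubble condition for `d ≥ 5`.

## What is formalised (namespace `Literature.Barriers.CriticalPhenomena`)

* `twoPointENN₁ d z x = G_z^{(1)}(x) ∈ [0, ∞]` and `hsBubble d z = ‖G_z^{(1)}‖₂² ∈ [0, ∞]`
  (real `z ≥ 0`; as for `twoPointENN`, no junk value is imposed at `z = z_c`);
* PROVED: `countAt_zero` (`c₀(x) = δ_{0,x}`), `countAt_succ_zero` (`cₙ(0) = 0` for `n ≥ 1`: a
  self-avoiding walk does not return to its starting point), `twoPointENN_eq_ite_add`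
  (`G_z = δ₀ + G_z^{(1)}`, (2.15)), `twoPointENN_zero` (`G_z(0) = 1`),
  `bubbleDiagram_eq_one_add_hsBubble` (`Σ_x G_z(x)² = 1 + ‖G_z^{(1)}‖₂²`);
* NAMED FACT `HaraSlade1992_thm25` — Theorem 2.5 for real `0 ≤ z ≤ z_c` (for complex `z` the
  printed statement follows from the real one, since `|G_z(x)| ≤ G_{|z|}(x)` termwise);
* PROVED: `HaraSlade1992_bubbleCondition_of_thm25 : HaraSlade1992_thm25 →
  HaraSlade1992_bubbleCondition` (`B(z_c) = 1 + ‖G_{z_c}^{(1)}‖₂² ≤ 1 + C₂ < ∞`, §3.1).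

What remains below `HaraSlade1992_thm25` is Part II, Theorem 1.1 (convergence of the lace
expansion for `d ≥ 5`); its own inputs — the expansion identity (Part I, Thm. 2.2), the
diagrammatic bounds (Part I, Lemmas 2.3–2.4) and the numerical simple-random-walk bounds — are
to be vendored and proved separately. The large-`d` analogue (Slade 2006, Thm. 5.1 from
Prop. 5.3 and Thm. 5.8) is `LaceExpansionConvergence.lean`.
-/

noncomputable section

open Literature.Probability.LatticeModels Literature.Probability.Percolation
  Literature.Probability.RandomPlanarGeometry.SAW.Zd
open scoped ENNReal BigOperators

namespace Literature.Barriers.CriticalPhenomena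

/-! ### `G_z^{(1)}` and Hara–Slade's bubble diagram `‖G_z^{(1)}‖₂²` -/

/-- `G_z^{(1)}(x) = Σ_{n=1}^∞ cₙ(x) zⁿ`, the two-point function without its `n = 0` term, valued in
`[0, ∞]` (for real `z ≥ 0`). [cite: HaraSlade1992, eq. (2.15)] -/
def twoPointENN₁ (d : ℕ) (z : ℝ) (x : Site d) : ℝ≥0∞ :=
  ∑' n : ℕ, (countAt d (n + 1) x : ℝ≥0∞) * ENNReal.ofReal z ^ (n + 1)

/-- Hara–Slade's bubble diagram `‖G_z^{(1)}(x)‖₂² = Σ_{x ∈ ℤ^d} G_z^{(1)}(x)² = Σ_{x ≠ 0} G_z(x)²`,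
valued in `[0, ∞]`. [cite: HaraSlade1992, eq. (1.14) and §3.1] -/
def hsBubble (d : ℕ) (z : ℝ) : ℝ≥0∞ :=
  ∑' x : Site d, twoPointENN₁ d z x ^ 2

/-- `c₀(x) = δ_{0,x}`: the only zero-step walk from `0` is the trivial one.
[cite: HaraSlade1992, §1.1 ("By convention, `c₀ = 1` and `c₀(x) = δ_{x,0}`")] -/
theorem countAt_zero (d : ℕ) (x : Site d) : countAt d 0 x = if x = 0 then 1 else 0 := by
  classical
  rw [← card_sawFun]
  split_ifs with hx
  · subst hx
    rw [Finset.card_eq_one]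
    refine ⟨fun _ => 0, Finset.eq_singleton_iff_unique_mem.2 ⟨?_, fun ω hω => ?_⟩⟩
    · rw [mem_sawFun]
      exact ⟨rfl, fun _ _ => rfl, fun i hi => absurd hi (Nat.not_lt_zero i),
        fun i hi j hj _ => by simp only [Set.mem_setOf_eq, Nat.le_zero] at hi hj; rw [hi, hj]⟩
    · obtain ⟨-, hend, -, -⟩ := mem_sawFun.1 hω
      funext i
      exact hend i (Nat.zero_le i)
  · rw [Finset.card_eq_zero, Finset.eq_empty_iff_forall_notMem]
    intro ω hω
    obtain ⟨h0, hend, -, -⟩ := mem_sawFun.1 hω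
    exact hx ((hend 0 le_rfl).symm.trans h0)

/-- `cₙ(0) = 0` for `n ≥ 1`: a self-avoiding walk with at least one step does not end where it
started. [cite: HaraSlade1992, §1.1] -/
theorem countAt_succ_zero (d n : ℕ) : countAt d (n + 1) 0 = 0 := by
  classical
  rw [← card_sawFun, Finset.card_eq_zero, Finset.eq_empty_iff_forall_notMem]
  intro ω hω
  obtain ⟨h0, hend, -, hinj⟩ := mem_sawFun.1 hω
  have h := hinj (show (0 : ℕ) ∈ {i | i ≤ n + 1} from Nat.zero_le _)
    (show n + 1 ∈ {i | i ≤ n + 1} from Set.mem_setOf.2 le_rfl) (h0.trans (hend (n + 1) le_rfl).symm)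
  omega

/-- `G_z(x) = δ_{0,x} + G_z^{(1)}(x)`. [cite: HaraSlade1992, eq. (2.15)] -/
theorem twoPointENN_eq_ite_add (d : ℕ) (z : ℝ) (x : Site d) :
    twoPointENN d z x = (if x = 0 then 1 else 0) + twoPointENN₁ d z x := by
  rw [twoPointENN, tsum_eq_zero_add' ENNReal.summable, countAt_zero]
  split_ifs <;> simp [twoPointENN₁]

/-- `G_z^{(1)}(0) = 0`. [cite: HaraSlade1992, eq. (2.15) and §1.1] -/
theorem twoPointENN₁_zero (d : ℕ) (z : ℝ) : twoPointENN₁ d z 0 = 0 := by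
  simp [twoPointENN₁, countAt_succ_zero]

/-- `G_z(0) = 1`. [cite: HaraSlade1992, eq. (2.15) and §1.1] -/
theorem twoPointENN_zero (d : ℕ) (z : ℝ) : twoPointENN d z 0 = 1 := by
  rw [twoPointENN_eq_ite_add, twoPointENN₁_zero, if_pos rfl, add_zero]

/-- `B(z) = Σ_x G_z(x)² = 1 + ‖G_z^{(1)}‖₂²`: the bubble diagram of Slade 2006 / Madras–Slade is one
plus that of Hara–Slade. [cite: HaraSlade1992, eq. (1.14) and §3.1] -/
theorem bubbleDiagram_eq_one_add_hsBubble (d : ℕ) (z : ℝ) :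
    bubbleDiagram d z = 1 + hsBubble d z := by
  classical
  rw [bubbleDiagram, ENNReal.tsum_eq_add_tsum_ite (0 : Site d), twoPointENN_zero, one_pow, hsBubble]
  congr 1
  refine tsum_congr fun x => ?_
  split_ifs with hx
  · rw [hx, twoPointENN₁_zero, zero_pow two_ne_zero]
  · rw [twoPointENN_eq_ite_add, if_neg hx, zero_add]

/-! ### Part I, Theorem 2.5, and the bubble condition for `d ≥ 5` -/

/-- **Hara–Slade 1992 (Part I), Theorem 2.5** — the output of the convergence proof of Part II
(Theorem II.1.1) used throughout Part I: "Let `d ≥ 5`. There are constants `C₁`, `C₂` such that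
for any `z` with `|z| ≤ z_c`, `‖|x|² G_z(x)‖_∞ ≤ C₁` and `‖G_z^{(1)}(x)‖₂² ≤ C₂`, with
`C₂(1 + C₂) < 1`." Stated for real `0 ≤ z ≤ z_c` (nearest-neighbour strictly self-avoiding walk
on `ℤ^d`, `z_c = 1/μ`, `|x|² = Σᵢ xᵢ²`); the complex case `|z| ≤ z_c` printed in the source is
equivalent, as `|G_z(x)| ≤ G_{|z|}(x)`. Not discharged here: its proof is Part II.
[cite: HaraSlade1992, Theorem 2.5] [cite: HaraSlade1992b, Theorem 1.1] -/
def HaraSlade1992_thm25 : Prop :=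
  ∀ d : ℕ, 5 ≤ d → ∃ C₁ C₂ : ℝ, C₂ * (1 + C₂) < 1 ∧
    ∀ z : ℝ, 0 ≤ z → z ≤ criticalPoint d →
      (∀ x : Site d, ENNReal.ofReal (normSq x) * twoPointENN d z x ≤ ENNReal.ofReal C₁) ∧
        hsBubble d z ≤ ENNReal.ofReal C₂

/-- **Theorem 2.5 ⇒ the bubble condition for `d ≥ 5`** (Part I, §3.1: "by Theorem 2.5 …
(3.1) holds"): `B(z_c) = 1 + ‖G_{z_c}^{(1)}‖₂² ≤ 1 + C₂ < ∞`.
[cite: HaraSlade1992, §3.1 (proof of Theorem 1.2)] -/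
theorem HaraSlade1992_bubbleCondition_of_thm25 (h : HaraSlade1992_thm25) :
    HaraSlade1992_bubbleCondition := by
  intro d hd
  obtain ⟨C₁, C₂, -, hC⟩ := h d hd
  have hzc : 0 ≤ criticalPoint d := by
    rw [criticalPoint]
    exact inv_nonneg.2 (Real.iInf_nonneg fun n => by positivity)
  obtain ⟨-, hB⟩ := hC (criticalPoint d) hzc le_rfl
  rw [BubbleCondition, bubbleDiagram_eq_one_add_hsBubble]
  exact ENNReal.add_lt_top.2 ⟨ENNReal.one_lt_top, lt_of_le_of_lt hB ENNReal.ofReal_lt_top⟩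

end Literature.Barriers.CriticalPhenomena
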